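import Literature.AlgebraicGeometry.Frobenioids.FinSubextCatGaloisCorrespondence
import Literature.AlgebraicGeometry.Frobenioids.QuasiTemperoidPushforward
import Literature.AlgebraicGeometry.Frobenioids.ArithmeticDivisorDataRingIsoTransport
import HarnessLib

/-!
# Frobenioids I Ex. 6.3 / Frobenioids II Ex. 1.3 (iii): a field automorphism `τ` of `F̄` inducing the
# topological automorphism `ψ` of `G_F = Gal(F̄/F)` LIFTS to the arithmetic Frobenioid over restriction along `ψ`

Mochizuki, *The geometry of Frobenioids II*, Kyushu J. Math. **62** (2008), §1 Example 1.3 (ii)–(iii) pp. 11–12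
("the pull-back functor `𝓑^temp(Π₂)⁰ → 𝓑^temp(Π₁)⁰` [i.e., obtained by composing the `Π₂`-action on a `Π₂`-set
`F₂` with `φ` …]"; "[cf. Example 1.1, (ii)]" — the Galois correspondence `X ↦ Spec F̄^{Stab(x_X)}`)
[cite: MochizukiFrdII2008, Ex 1.3 (iii) pp.11-12]; *The geometry of Frobenioids I*, Kyushu J. Math. **62**
(2008), §6 Example 6.3 p. 113 (the arithmetic divisor data `(Φ, B, div)` on `D = B(Gal(F̃/F))⁰`, functorial in
the fields) [cite: MochizukiFrdI2008, Ex. 6.3 p.113]; §5 Cor. 5.4 p. 104 [cite: MochizukiFrdI2008, Cor. 5.4 p.104].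

PROOF-ONLY file (cell abc-iut; seat abc-iut-w4-d109 gen 9, row C53ILIFT «COR53I-LIFTSALL@ARITH»: the LIFT half
behind the surjectivity `hlift⊛` of [IUTchI] Cor. 5.3 (i) at the genuine arithmetic model `ℱ^⊛(†𝒟^⊚)`).
SETTING: `G_F = GalFbar F` acting on `F̄ = Fbar F`; a continuous surjective endomorphism `ψ : G_F → G_F` and a
ring automorphism `τ` of `F̄` that INDUCES `ψ` in the sense `σ (τ x) = τ (ψ(σ) x)` — for `ψ⁻¹` a topological
automorphism this is exactly the output of the Neukirch–Uchida theorem in the tree's one-closure model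
(`Literature.NumberTheory.GaloisRepresentations.NeukirchUchida`, form (N0)); NOTHING of it is assumed here — this
file is the elementary construction for a GIVEN pair `(ψ, τ)`.

* `mem_fixFld_pullback_iff` — along abc-iut-L1's pull-back functor `P := QuasiTemperoid.pullback ψ`
  (restriction of scalars on `𝓑^temp(G_F)⁰`, same underlying sets and base points), the field of `P X` is
  `τ`(the field of `X`): `y ∈ F̄^{Stab_{P X}} ↔ τ⁻¹ y ∈ F̄^{Stab_X}`;
* `exists_ringEquiv_fixFld_pullback` — whence ring isomorphisms `e_X : F̄^{Stab_X} ≃+* F̄^{Stab_{P X}}`, `a ↦ τ a`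
  (NOT `F`-linear: `τ` moves `F`), and `coe_fieldMap_pullback_map` — they are natural for the Galois-correspondence
  maps `fieldMap f : a ↦ g_f · a` of abc-iut-w4-d018 (`τ (g_f a) = g' (τ a)` for any `g'` with `ψ g' = g_f`);
* **`exists_equivalence_over_of_twist`** — for ANY base functor `C : D ⥤ 𝓑^temp(G_F)⁰`, any `Θ : D ⥤ D` that is an
  equivalence and any identification `ξ : Θ ⋙ C ≅ C ⋙ P` ("`Θ` is restriction along `ψ` read through `C`"), the
  model Frobenioid of the arithmetic divisor data restricted along `C ⋙ galoisSubext F` ([FrdI] Ex. 6.3 over `D`;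
  for `C = BCat.connectedToBTemp` this IS [IUTchI] Ex. 5.1 (ii)'s `ℱ^⊛(†𝒟^⊚)` over `ℬ(G_F)⁰`) carries a
  self-EQUIVALENCE `Ψ` with `Ψ ⋙ Base = Base ⋙ Θ` ON THE NOSE — by abc-iut-w4-d109's
  `ArithDivisorData.exists_equivalence_over_of_ringEquiv` applied to the natural family
  `ρ_A := fieldMap(ξ_A) ∘ e_{C A} : F̄^{Stab_{C A}} ≃+* F̄^{Stab_{C (Θ A)}}`.

0 `def`, no instance, no notation, no named fact; nothing here bears on [IUTchIII] Cor. 3.12.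
-/

noncomputable section

namespace Literature.AlgebraicGeometry.Frobenioids

namespace QuasiTemperoid

open CategoryTheory Opposite Function
open Literature.AnabelianGeometry.SemiGraphs

universe v₁ u₁

section Pullback

variable {F : Type} [Field F] (ψ : GalFbar F →* GalFbar F) (hs : Surjective ψ) (hc : Continuous ψ)
  (τ : Fbar F ≃+* Fbar F) (hτ : ∀ (σ : GalFbar F) (x : Fbar F), σ (τ x) = τ (ψ σ x))

/-- The pull-back functor does not move base points (same underlying set, same chosen point).
[cite: MochizukiFrdII2008, Ex 1.3 (ii) p.11] -/
theorem basePt_pullback_obj (X : ConnectedPart (BTemp (GalFbar F))) :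
    basePt ((pullback ψ hs hc).obj X) = basePt X := rfl

/-- The action of `P X` is that of `X` precomposed with `ψ`. [cite: MochizukiFrdII2008, Ex 1.3 (ii) p.11] -/
theorem pullback_obj_ρ (X : ConnectedPart (BTemp (GalFbar F))) (σ : GalFbar F) (x : X.obj.obj.V) :
    ((pullback ψ hs hc).obj X).obj.obj.ρ σ x = X.obj.obj.ρ (ψ σ) x := rfl

/-- The pull-back functor does not move underlying maps. [cite: MochizukiFrdII2008, Ex 1.3 (ii) p.11] -/
theorem ptMap_pullback_map {X Y : ConnectedPart (BTemp (GalFbar F))} (f : X ⟶ Y) (x : X.obj.obj.V) :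
    ptMap ((pullback ψ hs hc).map f) x = ptMap f x := rfl

include hτ in
/-- **The field of `P X` is `τ` of the field of `X`**: for `τ` inducing `ψ` (`σ (τ x) = τ (ψ σ x)`),
`y ∈ F̄^{Stab_{P X}(x_X)} ↔ τ⁻¹ y ∈ F̄^{Stab_X(x_X)}` (`Stab_{P X} = ψ⁻¹ Stab_X`, `ψ` surjective).
[cite: MochizukiFrdII2008, Ex 1.3 (iii) pp.11-12] -/
theorem mem_fixFld_pullback_iff (X : ConnectedPart (BTemp (GalFbar F))) (y : Fbar F) :
    y ∈ fixFld F ((pullback ψ hs hc).obj X) ↔ τ.symm y ∈ fixFld F X := by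
  rw [mem_fixFld_iff, mem_fixFld_iff]
  constructor
  · intro h σ' hσ'
    obtain ⟨σ, rfl⟩ := hs σ'
    apply τ.injective
    rw [← hτ σ (τ.symm y), τ.apply_symm_apply]
    exact h σ hσ'
  · intro h σ hσ
    conv_lhs => rw [← τ.apply_symm_apply y]
    rw [hτ σ (τ.symm y), h (ψ σ) hσ]
    exact τ.apply_symm_apply y

include hτ in
/-- Forward form: `a ∈ F̄^{Stab_X} → τ a ∈ F̄^{Stab_{P X}}`. [cite: MochizukiFrdII2008, Ex 1.3 (iii) pp.11-12] -/
theorem apply_mem_fixFld_pullback (X : ConnectedPart (BTemp (GalFbar F))) {a : Fbar F} (ha : a ∈ fixFld F X) :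
    τ a ∈ fixFld F ((pullback ψ hs hc).obj X) := by
  rw [mem_fixFld_pullback_iff ψ hs hc τ hτ, τ.symm_apply_apply]
  exact ha

include hτ in
/-- **The ring isomorphisms `e_X : F̄^{Stab_X} ≃+* F̄^{Stab_{P X}}`, `a ↦ τ a`** (not `F`-linear in general).
[cite: MochizukiFrdII2008, Ex 1.3 (iii) pp.11-12] -/
theorem exists_ringEquiv_fixFld_pullback (X : ConnectedPart (BTemp (GalFbar F))) :
    ∃ e : fixFld F X ≃+* fixFld F ((pullback ψ hs hc).obj X), ∀ a : fixFld F X, (e a : Fbar F) = τ a := by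
  refine ⟨{ toFun := fun a => ⟨τ a, apply_mem_fixFld_pullback ψ hs hc τ hτ X a.2⟩
            invFun := fun b => ⟨τ.symm b, (mem_fixFld_pullback_iff ψ hs hc τ hτ X b).1 b.2⟩
            left_inv := fun a => Subtype.ext (τ.symm_apply_apply (a : Fbar F))
            right_inv := fun b => Subtype.ext (τ.apply_symm_apply (b : Fbar F))
            map_mul' := fun a b => Subtype.ext (map_mul τ (a : Fbar F) b)
            map_add' := fun a b => Subtype.ext (map_add τ (a : Fbar F) b) }, fun a => rfl⟩

include hτ in
/-- **Naturality of `a ↦ τ a` for the Galois-correspondence maps**: for `f : X → Y` in `𝓑^temp(G_F)⁰` and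
`a ∈ F̄^{Stab_Y}`, `fieldMap (P f) (τ a) = τ (fieldMap f a)` — if `g_f · x_Y = f(x_X)` and `ψ g' = g_f`, then `g'`
carries the base point of `P Y` to `(P f)(x_{P X})`, and `g' (τ a) = τ (g_f a)`.
[cite: MochizukiFrdII2008, Ex 1.3 (iii) pp.11-12] -/
theorem coe_fieldMap_pullback_map {X Y : ConnectedPart (BTemp (GalFbar F))} (f : X ⟶ Y) (a : fixFld F Y) :
    (fieldMap ((pullback ψ hs hc).map f) ⟨τ a, apply_mem_fixFld_pullback ψ hs hc τ hτ Y a.2⟩ : Fbar F) =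
      τ (fieldMap f a) := by
  obtain ⟨g', hg'⟩ := hs (carrier f)
  have hcarry : ((pullback ψ hs hc).obj Y).obj.obj.ρ g' (basePt ((pullback ψ hs hc).obj Y)) =
      ptMap ((pullback ψ hs hc).map f) (basePt ((pullback ψ hs hc).obj X)) := by
    rw [pullback_obj_ρ, hg', basePt_pullback_obj, basePt_pullback_obj, ptMap_pullback_map]
    exact carrier_spec f
  rw [fieldMap_apply_of_ρ_eq _ hcarry, fieldMap_apply_of_ρ_eq f (carrier_spec f) a]
  change g' (τ a) = τ (carrier f a)
  rw [hτ, hg']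

end Pullback

/-! ### The lift to the arithmetic Frobenioid over a twist of the base -/

section Lift

variable {F : Type} [Field F] [NumberField F] (ψ : GalFbar F →* GalFbar F) (hs : Surjective ψ)
  (hc : Continuous ψ) (τ : Fbar F ≃+* Fbar F) (hτ : ∀ (σ : GalFbar F) (x : Fbar F), σ (τ x) = τ (ψ σ x))
  {D : Type u₁} [Category.{v₁} D] (C : D ⥤ ConnectedPart (BTemp (GalFbar F))) (Θ : D ⥤ D)
  (ξ : Θ ⋙ C ≅ C ⋙ pullback ψ hs hc)

/-- The Galois-correspondence image of an isomorphism of `𝓑^temp(G_F)⁰` is an `F`-algebra isomorphism of the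
fields, `fieldMap i.hom` with inverse `fieldMap i.inv`. [cite: MochizukiFrdII2008, Ex 1.3 (iii) pp.11-12] -/
theorem fieldMap_hom_fieldMap_inv_apply {X Y : ConnectedPart (BTemp (GalFbar F))} (i : X ≅ Y) (b : fixFld F X) :
    fieldMap i.hom (fieldMap i.inv b) = b := by
  have h := congrArg FinSubextCat.Hom.toAlgHom (((galoisSubext F).mapIso i).hom_inv_id)
  exact DFunLike.congr_fun h b

/-- … and `fieldMap i.inv (fieldMap i.hom a) = a`. [cite: MochizukiFrdII2008, Ex 1.3 (iii) pp.11-12] -/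
theorem fieldMap_inv_fieldMap_hom_apply {X Y : ConnectedPart (BTemp (GalFbar F))} (i : X ≅ Y) (a : fixFld F Y) :
    fieldMap i.inv (fieldMap i.hom a) = a := by
  have h := congrArg FinSubextCat.Hom.toAlgHom (((galoisSubext F).mapIso i).inv_hom_id)
  exact DFunLike.congr_fun h a

include hτ in
/-- **The natural family of ring isomorphisms `ρ_A : F̄^{Stab_{C A}} ≃+* F̄^{Stab_{C (Θ A)}}`** along a twist
`ξ : Θ ⋙ C ≅ C ⋙ P` of the base: `ρ_A := fieldMap(ξ_A) ∘ (a ↦ τ a)`, natural for the Galois-correspondence maps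
along `C`: `ρ_A (g_{C f} · a) = g_{C (Θ f)} · ρ_{A'}(a)`. [cite: MochizukiFrdII2008, Ex 1.3 (iii) pp.11-12] -/
theorem exists_ringEquiv_family_of_twist :
    ∃ ρ : ∀ A : D, fixFld F (C.obj A) ≃+* fixFld F (C.obj (Θ.obj A)),
      (∀ (A : D) (a : fixFld F (C.obj A)),
        ρ A a = fieldMap (ξ.hom.app A) ⟨τ a, apply_mem_fixFld_pullback ψ hs hc τ hτ (C.obj A) a.2⟩) ∧
      ∀ ⦃A A' : D⦄ (f : A ⟶ A') (a : fixFld F (C.obj A')),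
        ρ A (fieldMap (C.map f) a) = fieldMap (C.map (Θ.map f)) (ρ A' a) := by
  -- the `F`-algebra isomorphisms `fieldMap ξ_A : F̄^{Stab_{P (C A)}} ≃ F̄^{Stab_{C (Θ A)}}`
  let j : ∀ A : D, fixFld F ((pullback ψ hs hc).obj (C.obj A)) ≃ₐ[F] fixFld F (C.obj (Θ.obj A)) := fun A =>
    AlgEquiv.ofAlgHom (fieldMap (ξ.hom.app A)) (fieldMap (ξ.inv.app A))
      (AlgHom.ext fun b => fieldMap_hom_fieldMap_inv_apply (ξ.app A) b)
      (AlgHom.ext fun a => fieldMap_inv_fieldMap_hom_apply (ξ.app A) a)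
  have hj : ∀ (A : D) (b : fixFld F ((pullback ψ hs hc).obj (C.obj A))), j A b = fieldMap (ξ.hom.app A) b :=
    fun A b => rfl
  choose e he using fun A : D => exists_ringEquiv_fixFld_pullback ψ hs hc τ hτ (C.obj A)
  have he' : ∀ (A : D) (a : fixFld F (C.obj A)),
      e A a = ⟨τ a, apply_mem_fixFld_pullback ψ hs hc τ hτ (C.obj A) a.2⟩ := fun A a => Subtype.ext (he A a)
  refine ⟨fun A => (e A).trans (j A).toRingEquiv, fun A a => ?_, fun A A' f a => ?_⟩
  · change j A (e A a) = _
    rw [hj, he']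
    rfl
  · change j A (e A (fieldMap (C.map f) a)) = fieldMap (C.map (Θ.map f)) (j A' (e A' a))
    rw [hj, hj, he', he']
    -- `τ (g_{C f} a) = fieldMap (P (C f)) (τ a)`
    have h1 : (⟨τ (fieldMap (C.map f) a),
          apply_mem_fixFld_pullback ψ hs hc τ hτ (C.obj A) (fieldMap (C.map f) a).2⟩ :
        fixFld F ((pullback ψ hs hc).obj (C.obj A))) =
        fieldMap ((pullback ψ hs hc).map (C.map f)) ⟨τ a, apply_mem_fixFld_pullback ψ hs hc τ hτ (C.obj A') a.2⟩ :=
      Subtype.ext (coe_fieldMap_pullback_map ψ hs hc τ hτ (C.map f) a).symm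
    rw [h1]
    -- naturality of `ξ`: `C (Θ f) ≫ ξ_{A'} = ξ_A ≫ P (C f)`
    have h2 : (Θ ⋙ C).map f ≫ ξ.hom.app A' = ξ.hom.app A ≫ (C ⋙ pullback ψ hs hc).map f :=
      ξ.hom.naturality f
    apply Subtype.ext
    calc (fieldMap (ξ.hom.app A) (fieldMap ((pullback ψ hs hc).map (C.map f))
            ⟨τ a, apply_mem_fixFld_pullback ψ hs hc τ hτ (C.obj A') a.2⟩) : Fbar F)
        = fieldMap (ξ.hom.app A ≫ (C ⋙ pullback ψ hs hc).map f)
            ⟨τ a, apply_mem_fixFld_pullback ψ hs hc τ hτ (C.obj A') a.2⟩ := fieldMap_comp_apply _ _ _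
      _ = fieldMap ((Θ ⋙ C).map f ≫ ξ.hom.app A')
            ⟨τ a, apply_mem_fixFld_pullback ψ hs hc τ hτ (C.obj A') a.2⟩ := by rw [h2]
      _ = fieldMap (C.map (Θ.map f)) (fieldMap (ξ.hom.app A')
            ⟨τ a, apply_mem_fixFld_pullback ψ hs hc τ hτ (C.obj A') a.2⟩) := (fieldMap_comp_apply _ _ _).symm

include hτ ξ in
/-- **The lift.**  For `τ` inducing `ψ` on `G_F` and a twist `ξ : Θ ⋙ C ≅ C ⋙ pullback ψ` of an equivalence `Θ`
of the base `D` read through `C : D ⥤ 𝓑^temp(G_F)⁰`, the model Frobenioid of the arithmetic divisor data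
`(Φ, B, div)` of [FrdI] Ex. 6.3 restricted along `C ⋙ galoisSubext F` admits a self-equivalence `Ψ` lying over
`Θ` ON THE NOSE (`Ψ ⋙ Base = Base ⋙ Θ`) and preserving Frobenius degrees — the functor induced by the morphism of
model data `(ρ_A^*, ρ_A)` (abc-iut-w4-d109 `ArithDivisorData.exists_equivalence_over_of_ringEquiv`, [FrdI] Cor. 5.4).
[cite: MochizukiFrdI2008, Ex. 6.3 p.113] -/
theorem exists_equivalence_over_of_twist [Θ.IsEquivalence] :
    ∃ Ψ : ModelFrobenioid ((C ⋙ galoisSubext F).op ⋙ arithDivisorFunctor F (Fbar F))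
          ((C ⋙ galoisSubext F).op ⋙ unitsFunctor F (Fbar F))
          (ModelFrobenioid.divBRestrict (C ⋙ galoisSubext F) (arithDivisorFunctor F (Fbar F))
            (unitsFunctor F (Fbar F)) (divNatTrans F (Fbar F))) ≌
        ModelFrobenioid ((C ⋙ galoisSubext F).op ⋙ arithDivisorFunctor F (Fbar F))
          ((C ⋙ galoisSubext F).op ⋙ unitsFunctor F (Fbar F))
          (ModelFrobenioid.divBRestrict (C ⋙ galoisSubext F) (arithDivisorFunctor F (Fbar F))
            (unitsFunctor F (Fbar F)) (divNatTrans F (Fbar F))),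
      Ψ.functor ⋙ ModelFrobenioid.baseFunctor _ _ _ = ModelFrobenioid.baseFunctor _ _ _ ⋙ Θ ∧
      ∀ ⦃X Y⦄ (φ : X ⟶ Y), ModelFrobenioid.degFr (Ψ.functor.map φ) = ModelFrobenioid.degFr φ := by
  obtain ⟨ρ, -, hρ⟩ := exists_ringEquiv_family_of_twist ψ hs hc τ hτ C Θ ξ
  exact ArithDivisorData.exists_equivalence_over_of_ringEquiv (C ⋙ galoisSubext F) (C ⋙ galoisSubext F) Θ ρ hρ

end Lift

end QuasiTemperoid

end Literature.AlgebraicGeometry.Frobenioids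

end
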